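import Summits.BirchSwinnertonDyer.Rank1Residual.Supersingular.X7VisibilityShapeFiveKinds
import Summits.BirchSwinnertonDyer.Rank1Residual.Supersingular.CountPointsFast
import Summits.BirchSwinnertonDyer.Rank1Residual.Supersingular.SurjSerreCertificateShape
import HarnessLib

/-!
# NON-split multiplicative reduction at a LARGE prime by Euler's criterion (TOOL): root-freeness of the node-tangent
# quadratic from a non-residue discriminant, the power computed by `powModFast`

Cell `b2b-bsdres`, supersingular family, prover A = unit `b2b-bsdres-x10b` (gen 16).  Topic file; namespace
`Summit.BirchSwinnertonDyer.Rank1Residual.Supersingular`.  TOOL (theorems only; no definition, no named fact, nothing booked).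

HONEST FRAMING (run/shared/lean/b2b/bsd-rank1-residual/, verbatim in every file): the goal of the cell is to
DELETE the COMBINATION-SHAPED residual classes of the Birch–Swinnerton-Dyer formula for ALL analytic-rank `≤ 1`
elliptic curves over `ℚ` — "full BSD formula for every rank `≤ 1` curve in class `C`" assembled STRICTLY from
published theorems — so that the rank-`≤ 1` remainder becomes exactly the CONSTRUCTION-SHAPED classes, which are
TYPED (missing-input `Prop`s), NOT attempted.  This is not "finishing BSD".

## Why

Kind (iv) of the visibility count (Fisher 2016 Thm. 4.4: one curve NON-split multiplicative, the other good) is decided in the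
records by `not_hasSplitMultiplicativeReductionAt_of_intModel_of_noroot`, whose hypothesis `∀ t : ZMod ℓ, q(t) ≠ 0` is
`decide`d by enumerating `ZMod ℓ` — fine at `ℓ = 19`, impossible at the level-raising primes `ℓ ≈ 10⁷–10⁸` of the
wave-2 partners (x10b gen 16: `483238k1 @ 5`, partner non-split at `ℓ = 72 728 489`).  Here root-freeness is read off
Euler's criterion instead: a root `t` of `c₄t² + a₁c₄t − C` gives the square `(2c₄t + a₁c₄)² = a₁²c₄² + 4c₄C`, so a
NON-residue discriminant excludes roots (`noroot_of_not_isSquare`); the non-residue is certified by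
`d^{(ℓ−1)/2} ≡ −1 (mod ℓ)` with the power computed by the tree's `powModFast` (`≈ log₂ ℓ` kernel multiplications,
`pow_div_two_eq_neg_one_of_powModFast`), and `not_hasSplitMultiplicativeReductionAt_of_intModel_of_euler` packages the
place-indexed conclusion.

References: Silverman AEC VII.5.1(b) [SilvermanAEC2009]; Ireland–Rosen Prop. 5.1.2 (Euler's criterion) [IrelandRosen1990].
-/

set_option autoImplicit false

open WeierstrassCurve IsDedekindDomain
open NumberField

namespace Summit.BirchSwinnertonDyer.Rank1Residual.Supersingular

/-- **Euler's criterion through `powModFast`**: `powModFast (ℓ/2+1) d (ℓ/2) ℓ = ℓ − 1` gives `(d : ZMod ℓ)^(ℓ/2) = −1`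
(`1 < ℓ`). [cite: IrelandRosen1990, Prop. 5.1.2 (Euler's criterion)] -/
theorem pow_div_two_eq_neg_one_of_powModFast (ℓ d : ℕ) (hℓ : 1 < ℓ)
    (h : powModFast (ℓ / 2 + 1) d (ℓ / 2) ℓ = ℓ - 1) : ((d : ZMod ℓ)) ^ (ℓ / 2) = -1 := by
  have hlt : ℓ / 2 < 2 ^ (ℓ / 2 + 1) :=
    (Nat.lt_two_pow_self).trans (Nat.pow_lt_pow_right (by norm_num) (by omega))
  rw [powModFast_eq _ _ _ _ hlt] at h
  have h1 : ((d ^ (ℓ / 2) % ℓ : ℕ) : ZMod ℓ) = ((ℓ - 1 : ℕ) : ZMod ℓ) := by rw [h]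
  rw [ZMod.natCast_mod, Nat.cast_pow, Nat.cast_sub (le_of_lt hℓ), ZMod.natCast_self, Nat.cast_one, zero_sub] at h1
  exact h1

/-- **No root from a non-residue discriminant**: over `ZMod ℓ` with `2c₄` invertible, a root `t` of
`c₄t² + (a₁c₄)t − C` makes `a₁²c₄² + 4c₄C = (2c₄t + a₁c₄)²` a square; so if that discriminant is a non-square the
quadratic is root-free. [cite: SilvermanAEC2009, VII.5 Prop. 5.1(b)] -/
theorem noroot_of_not_isSquare {ℓ : ℕ} (c4 a1 C : ZMod ℓ)
    (hns : ¬ IsSquare (a1 ^ 2 * c4 ^ 2 + 4 * c4 * C)) :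
    ∀ t : ZMod ℓ, c4 * t ^ 2 + (a1 * c4) * t - C ≠ 0 := by
  intro t ht
  apply hns
  refine ⟨2 * c4 * t + a1 * c4, ?_⟩
  linear_combination (-4 * c4) * ht

/-- NON-split multiplicative reduction at the place `w` over `ℓ` from the integer model `E₀` and an EULER certificate:
`ℓ ∣ Δ(E₀)`, `ℓ ∤ c₄(E₀)`, and `powModFast` says the discriminant `a₁²c₄² + 4c₄(54b₆ − 3b₂b₄ + a₂c₄)` of the node-tangent
quadratic is a non-residue mod `ℓ` (`d` = that discriminant reduced into `[0, ℓ)`).  For the level-raising primes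
`ℓ ≈ 10⁷–10⁸` of wave-2 partners, where enumerating `ZMod ℓ` is out of reach.
[cite: SilvermanAEC2009, VII.5 Prop. 5.1(b)] [cite: IrelandRosen1990, Prop. 5.1.2 (Euler's criterion)] -/
theorem not_hasSplitMultiplicativeReductionAt_of_intModel_of_euler {W : WeierstrassCurve ℚ} [W.IsElliptic]
    [W.IsGloballyMinimal] {E₀ : WeierstrassCurve ℤ} (hI : integralModelInt W = E₀)
    (w : HeightOneSpectrum (𝓞 ℚ)) {ℓ : ℕ} [hℓ : Fact ℓ.Prime] (hw : (Rat.HeightOneSpectrum.primesEquiv w : ℕ) = ℓ)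
    (hℓ2 : ℓ ≠ 2) (hΔ : (ℓ : ℤ) ∣ E₀.Δ) (hc₄ : ¬ (ℓ : ℤ) ∣ E₀.c₄) (d : ℕ)
    (hd : ((E₀.a₁ : ZMod ℓ)) ^ 2 * (E₀.c₄ : ZMod ℓ) ^ 2 +
      4 * (E₀.c₄ : ZMod ℓ) * (54 * E₀.b₆ - 3 * E₀.b₂ * E₀.b₄ + E₀.a₂ * E₀.c₄ : ZMod ℓ) = (d : ZMod ℓ))
    (heuler : powModFast (ℓ / 2 + 1) d (ℓ / 2) ℓ = ℓ - 1) :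
    ¬ W.HasSplitMultiplicativeReductionAt w := by
  have hns : ¬ IsSquare ((d : ZMod ℓ)) :=
    (not_isSquare_of_pow_div_two_eq_neg_one ℓ hℓ2
      (pow_div_two_eq_neg_one_of_powModFast ℓ d hℓ.out.one_lt heuler)).1
  refine not_hasSplitMultiplicativeReductionAt_of_intModel_of_noroot hI w hw hΔ hc₄ ?_
  have key := noroot_of_not_isSquare (E₀.c₄ : ZMod ℓ) (E₀.a₁ : ZMod ℓ)
    (54 * E₀.b₆ - 3 * E₀.b₂ * E₀.b₄ + E₀.a₂ * E₀.c₄ : ZMod ℓ) (by rw [hd]; exact hns)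
  intro t
  convert key t using 2

end Summit.BirchSwinnertonDyer.Rank1Residual.Supersingular
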